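/-
Copyright: the b2b-balaban cell (near-miss cell 7), T⁴-continuum fan-out; row NE7b ROUND-2 swarm, seat
t4-ne7b-formalise-leaf-05 gen 10 (row S12o «CONCAVE ENTROPY REPAIR» of `t4/b2b-balaban-t4-ne7b-p1/LEAVES-NE7b.md`, part
(ii) «THE WIRING» — the junction (ii) × (iii) in the kernel; owner's ruling R-OWNER-23-15 and division of labour, journal
l.17861 ∕ l.17953 ∕ l.18163; CLAIM l.17968).  Released under the licence of the surrounding project.
-/
import Summits.QuantumFields.BalabanUV.T4Continuum.Support.HistoryAssemblyMultInstanceTwin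
import Summits.QuantumFields.BalabanUV.T4Continuum.Support.HistoryJoinsPlacedTwinConcave

/-!
# Row S6g′'s INSTANCE AT THE CONCAVE CONSTANT `ΘJc` — the plug (ii) × (iii), named (row S12o)

Summits-side support leaf of the T⁴-continuum cell (rung (B)+1 on a FINITE torus only; NOT infinite volume, NOT the
mass gap, NOT the Clay statement; NOT a proof of the spine estimate NE7b).  Row NE7b, route «COUNT»; smallness-census
rows S12n ∕ S12o.  leaf-08 g11's part (iii) made the instance ∕ END chain below the pinned level CONSTANT-AGNOSTIC
(`HistoryAssemblyMultInstanceTwin.card_koccOf_le_exp_of_twin`: the twin END's bound is the HYPOTHESIS `htwin` at an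
arbitrary `Θ₀`; its fidelity `example` re-derives the tree's `card_koccOf_le_exp` with the three-line lambda over gen 4's
twin END).  This file WRITES THAT LAMBDA ONCE, BY NAME, for part (ii)'s concave twin END
(`HistoryJoinsPlacedTwinConcave.card_S_sortR_le_exp_pow'`, this seat): `htwin_concave` is the `htwin` family at
`Θ₀ := ΘJc d sS θc` (collar 32, stride `sS`, decay `θc`), and `card_koccOf_le_exp_concave` is the tree's instance statement
with the threshold `θ ≥ ΘJc d sS θc + 8·2^d·log(2d+1)` in place of `θ ≥ ΘJ d sS θc + 8·2^d·log(2d+1)` — so part (iv)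
(leaf-02 lineage: pinned ∕ headline over leaf-08 g11's generic ENDs) quotes ONE name.  [folklore] composition BY NAME;
nothing is quoted from print, nothing printed is asserted, no `[cite:]` tag, no `Prop` fact, no definition, constants
symbolic (c2∕c6: `32` is the tree's collar letter of `ΘJ`, as in the fidelity `example`); no landed file edited; no END of
record ∕ exit ∕ socket ∕ `HistoryConstants*` file touched (c3).

THE LETTER (docstring letter, as `ΘJ`): with `A₁ = (2·cth 32 1 sS + 1)^d`, `A = A₁·5^d`, `C₁ = 65^d`, `Cr = 4·2^d`,
`WB = 2A₁·C₁·Cr`, `WM = 4A`, `γ′ = 2A`, `ρℓ = max 1 66`, `X = (WB+WM)∕(1−θc)`, `d₁ = 2·log(2d+1)`, `Ω = ρℓ·X + ρℓ·γ′ + 1`: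
  **`ΘJc d sS θc = 1 + log(X + 2γ′) + (0 + 3d₁ + 2d + d₁·Cr + d·log(2Ω(1 + Cr) + 1)) + 10`.**

HONEST SCOPE.  Bookkeeping junction over OUR carriers; every displayed hypothesis of the instance unchanged (`RealisedDomainsR`,
`hdis`, the profile's monotonicity ∕ drop control ∕ `R ≥ 1`, the stride∕smallness∕decay side conditions, the floor signs);
the END of record v3.1′ (p223694), the socket, the exits, `HistoryConstants*` and the headline Prop (p224237) are
UNTOUCHED here (part (iv) re-homes them; then only the hidden ∃-bound `g₁` moves).  NE7b NOT proved; spine 0∕9.  HONEST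
DEPENDENCY (cell): continuum YM on T⁴ ⇐ BetaPertH ∧ nine spine estimates (0/9 proved); BetaPertH ⇐ (D1) ∧ (D4) ∧
CAP+tail; G-an2-4 gates asym, D1 and NE2/3/4.  This file changes none of it.
-/

open Finset
open Literature.MathematicalPhysics.QuantumFieldTheory.Balaban1983to89
open Literature.MathematicalPhysics.QuantumFieldTheory.Balaban1983to89.B13ScaleTransfer (Pt FaceConnected)
open Literature.MathematicalPhysics.QuantumFieldTheory.Balaban1983to89.B16SProfile (DropCtl)
open T4PersistenceDictionary T4PrintedShapeBanking T4TaggedShapeBanking T4PartnerMultiplicity T4BranchingRecordsGas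
open Summit.QuantumFields.BalabanUV.T4Continuum.ZoneTorus
open Summit.QuantumFields.BalabanUV.T4Continuum.ZoneSkeleton
open Summit.QuantumFields.BalabanUV.T4Continuum.HistoryZones
open Summit.QuantumFields.BalabanUV.T4Continuum.HistoryZoneEvolve (cth)
open Summit.QuantumFields.BalabanUV.T4Continuum.HistoryAdmissible
open Summit.QuantumFields.BalabanUV.T4Continuum.HistoryRealise
open Summit.QuantumFields.BalabanUV.T4Continuum.HistoryRealiseCells
open Summit.QuantumFields.BalabanUV.T4Continuum.HistoryRealiseCellsRun
open Summit.QuantumFields.BalabanUV.T4Continuum.HistoryRealiseDistinct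
open Summit.QuantumFields.BalabanUV.T4Continuum.HistoryGen
open Summit.QuantumFields.BalabanUV.T4Continuum.HistoryJoins
open Summit.QuantumFields.BalabanUV.T4Continuum.HistoryJoinsAdm
open Summit.QuantumFields.BalabanUV.T4Continuum.HistoryAssemblyTerms
open Summit.QuantumFields.BalabanUV.T4Continuum.HistoryAssemblyPedigree
open Summit.QuantumFields.BalabanUV.T4Continuum.HistoryAssemblyMultKey
open Summit.QuantumFields.BalabanUV.T4Continuum.HistoryAssemblyMultLetters
open Summit.QuantumFields.BalabanUV.T4Continuum.HistoryRegionTemplates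
open Summit.QuantumFields.BalabanUV.T4Continuum.HistoryJoinsTemplates
open Summit.QuantumFields.BalabanUV.T4Continuum.HistoryJoinsPlacedZone
open Summit.QuantumFields.BalabanUV.T4Continuum.HistoryJoinsPlacedValue
open Summit.QuantumFields.BalabanUV.T4Continuum.HistoryJoinsPlacedMember
open Summit.QuantumFields.BalabanUV.T4Continuum.HistoryJoinsPlacedTwin
open Summit.QuantumFields.BalabanUV.T4Continuum.HistoryJoinsPlacedTwinConcave
open Summit.QuantumFields.BalabanUV.T4Continuum.HistoryJoinsPlacedMult
open Summit.QuantumFields.BalabanUV.T4Continuum.HistorySiblingEntropyBridge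
open Summit.QuantumFields.BalabanUV.T4Continuum.HistoryBankingLE
open Summit.QuantumFields.BalabanUV.T4Continuum.HistoryConstants
open Summit.QuantumFields.BalabanUV.T4Continuum.HistoryCaps
open Summit.QuantumFields.BalabanUV.T4Continuum.HistoryZoneMassLawLevels
open Summit.QuantumFields.BalabanUV.T4Continuum.HistoryRenewalsCost
open Summit.QuantumFields.BalabanUV.T4Continuum.PlacementSkeleton
open Summit.QuantumFields.BalabanUV.T4Continuum.HistoryAssemblyMultInstance
open Summit.QuantumFields.BalabanUV.T4Continuum.HistoryAssemblyMultInstanceTwin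

namespace Summit.QuantumFields.BalabanUV.T4Continuum.HistoryAssemblyMultInstanceConcave

noncomputable section

open scoped Classical

section Instance

variable {ι α π : Type*} [DecidableEq α] [DecidableEq π] {d n L K₀ : ℕ} {C : T4PrintedShapeBanking.Consts}
  {s R : ℕ → ℕ → ℕ} {T : ℕ → Finset ι} {ped : ℕ → ι → Pedigree α π} {cellP : ℕ → ι → π → Pt d × Finset (Pt d)}
  {liveC : ℕ → ι → Finset α} {Zd : ℕ → ι → α → Finset (Pt d)}

/-- **THE `htwin` FAMILY AT `Θ₀ := ΘJc d sS θc`** — leaf-08 g11's three-line lambda written once, over part (ii)'s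
concave twin END `HistoryJoinsPlacedTwinConcave.card_S_sortR_le_exp_pow'`: for a realised-domains reading `H`, a
non-increasing drop-controlled profile, `R ≥ 1`, floor signs `0 < E₂`, `0 ≤ E₃`, and the count's stride∕smallness∕decay
side conditions at collar 32, the twin bound holds for every run `K ≥ K₀`, term, live component (`ConsistentTLE`, step
`≤ K`), template size, address depth, root datum and order. [folklore] -/
theorem htwin_concave (hn : 0 < n) (hL0 : 0 < L) (hE₂ : 0 < C.E₂) (hE₃ : 0 ≤ C.E₃)
    (hs : ∀ K, K₀ ≤ K → ∀ t, s K (t + 1) ≤ s K t) (hdrop : ∀ K, K₀ ≤ K → ∀ m, DropCtl (s K) m)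
    (hR1 : ∀ K, K₀ ≤ K → ∀ t, 1 ≤ R K t)
    (H : RealisedDomainsR L s n K₀ R T ped cellP liveC Zd)
    {sS : ℕ} (hsS : 1 ≤ sS)
    (hsmall : (((2 * cth 32 1 sS + 1) ^ d : ℕ) : ℝ) * (5 : ℝ) ^ d * ((max 1 (2 * 32 + 2) : ℕ) : ℝ) ≤
      (L : ℝ) ^ (sS / 2) / 2)
    {θc : ℝ} (hθc0 : 0 ≤ θc) (hθc1 : θc < 1) (hθcs : 1 / 2 ≤ θc ^ sS) :
    ∀ K, K₀ ≤ K → ∀ τ ∈ T K, ∀ c ∈ liveC K τ,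
      ConsistentTLE Prod.fst C K (R K) ((ped K τ).genT c) → (ped K τ).step c ≤ K →
      ∀ (Mz Dz : ℕ) (c₀ : TCell d (n * L ^ K) × Template d Mz)
        (ρ : (Addr Dz → TCell d (n * L ^ K) × Template d Mz) → ℕ) (z : TCell d (n * L ^ K) × Template d Mz),
      ((S (zoneP n L K (levelOf (s K) K) 32 c₀) ρ c₀ PEv.step ((ped K τ).sortR.gen c) z).card : ℝ) ≤
        Real.exp ((1 + Real.log
            ((2 * (((2 * cth 32 1 sS + 1) ^ d : ℕ) : ℝ) * ((((2 * 32 + 1) ^ d : ℕ) : ℝ) * (4 * 2 ^ d)) +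
                  4 * ((((2 * cth 32 1 sS + 1) ^ d : ℕ) : ℝ) * (5 : ℝ) ^ d)) / (1 - θc) +
              2 * (2 * ((((2 * cth 32 1 sS + 1) ^ d : ℕ) : ℝ) * (5 : ℝ) ^ d))) +
            (0 + 3 * (2 * Real.log (2 * d + 1)) + 2 * (d : ℝ) + 2 * Real.log (2 * d + 1) * (4 * 2 ^ d) +
              (d : ℝ) * Real.log (2 *
                ((((max 1 (2 * 32 + 2) : ℕ) : ℝ) *
                      ((2 * (((2 * cth 32 1 sS + 1) ^ d : ℕ) : ℝ) * ((((2 * 32 + 1) ^ d : ℕ) : ℝ) * (4 * 2 ^ d)) +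
                          4 * ((((2 * cth 32 1 sS + 1) ^ d : ℕ) : ℝ) * (5 : ℝ) ^ d)) / (1 - θc)) +
                    ((max 1 (2 * 32 + 2) : ℕ) : ℝ) * (2 * ((((2 * cth 32 1 sS + 1) ^ d : ℕ) : ℝ) * (5 : ℝ) ^ d)) + 1) *
                  (1 + 4 * 2 ^ d)) + 1)) +
            10) * bsum (fun b => ((b.fat : ℕ) : ℝ) + 1) ((ped K τ).gen c) +
            8 / C.E₂ * totalCostT Prod.fst C K (R K) ((ped K τ).genT c)) *
          (((L : ℝ) ^ d) * Real.exp 4) ^ partnerAges PEv.step ((ped K τ).gen c) := by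
  intro K' hK' τ' hτ' c' _ hcons hKs Mz Dz c₀ ρ z
  have hlv : LevelFn K' (levelOf (s K') K') := levelFn_levelOf (fun t _ => hs K' hK' t) (hdrop K' hK' K')
  have hφ : ∀ m, m ≤ K' → C.E₂ ≤ floorK C K' (R K') m := fun m hm => by
    simpa using le_floorK_of_le (C := C) (K := K') (R := R K') hE₂.le hm (hR1 K' hK' m)
  exact card_S_sortR_le_exp_pow' (ped K' τ') ρ (H.headOldest K' hK' τ' hτ') (H.renew_step K' hK' τ' hτ')
    (H.forest K' hK' τ' hτ') hE₂.le hE₃ hE₂ hφ c' hcons hKs hL0 hn hlv hsS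
    (fun u _ => levelFn_add_half_le hlv u sS) hsmall hθc0 hθc1 hθcs z

/-- **ROW S6g′'s INSTANCE AT THE CONCAVE CONSTANT** — the tree's `HistoryAssemblyMultInstance.card_koccOf_le_exp`
(statement VERBATIM: binders, conclusion) with the threshold `θ ≥ ΘJ d sS θc + 8·2^d·log(2d+1)` REPLACED by
`θ ≥ ΘJc d sS θc + 8·2^d·log(2d+1)`: leaf-08 g11's generic `card_koccOf_le_exp_of_twin` with `htwin := htwin_concave …`.
[folklore] -/
theorem card_koccOf_le_exp_concave (hn : 0 < n) (hL0 : 0 < L) (hL4 : 4 ≤ L) (hn₁ : 13 ≤ C.n₁) (hE₂ : 0 < C.E₂)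
    (hE₃ : 0 ≤ C.E₃) {M : ℕ → ℕ} (hM : ∀ K, 1 ≤ M K)
    (hs : ∀ K, K₀ ≤ K → ∀ t, s K (t + 1) ≤ s K t) (hdrop : ∀ K, K₀ ≤ K → ∀ m, DropCtl (s K) m)
    (hR1 : ∀ K, K₀ ≤ K → ∀ t, 1 ≤ R K t)
    (H : RealisedDomainsR L s n K₀ R T ped cellP liveC Zd)
    (hstep : ∀ K, K₀ ≤ K → ∀ τ ∈ T K, ∀ c ∈ liveC K τ, (ped K τ).step c ≤ K)
    (hMf : ∀ K, K₀ ≤ K → ∀ τ ∈ T K, ∀ c ∈ liveC K τ, ∀ bz ∈ ((ped K τ).toPGen (cellP K τ) c).pbirths,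
      tcap d bz.1.fat ≤ M K)
    (jstar : ℕ → ℕ)
    (hdis : ∀ K, K₀ ≤ K → ∀ τ ∈ badTerms (memOf ped liveC (cellOfR n L s ped cellP)) jstar T K, ∀ c ∈ liveC K τ,
      (physV n L hn hL0 M hM s ped cellP K τ c).Nodup)
    {sS : ℕ} (hsS : 1 ≤ sS)
    (hsmall : (((2 * cth 32 1 sS + 1) ^ d : ℕ) : ℝ) * (5 : ℝ) ^ d * ((max 1 (2 * 32 + 2) : ℕ) : ℝ) ≤
      (L : ℝ) ^ (sS / 2) / 2)
    {θc : ℝ} (hθc0 : 0 ≤ θc) (hθc1 : θc < 1) (hθcs : 1 / 2 ≤ θc ^ sS)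
    {θ : ℝ} (hθ : (1 + Real.log
            ((2 * (((2 * cth 32 1 sS + 1) ^ d : ℕ) : ℝ) * ((((2 * 32 + 1) ^ d : ℕ) : ℝ) * (4 * 2 ^ d)) +
                  4 * ((((2 * cth 32 1 sS + 1) ^ d : ℕ) : ℝ) * (5 : ℝ) ^ d)) / (1 - θc) +
              2 * (2 * ((((2 * cth 32 1 sS + 1) ^ d : ℕ) : ℝ) * (5 : ℝ) ^ d))) +
            (0 + 3 * (2 * Real.log (2 * d + 1)) + 2 * (d : ℝ) + 2 * Real.log (2 * d + 1) * (4 * 2 ^ d) +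
              (d : ℝ) * Real.log (2 *
                ((((max 1 (2 * 32 + 2) : ℕ) : ℝ) *
                      ((2 * (((2 * cth 32 1 sS + 1) ^ d : ℕ) : ℝ) * ((((2 * 32 + 1) ^ d : ℕ) : ℝ) * (4 * 2 ^ d)) +
                          4 * ((((2 * cth 32 1 sS + 1) ^ d : ℕ) : ℝ) * (5 : ℝ) ^ d)) / (1 - θc)) +
                    ((max 1 (2 * 32 + 2) : ℕ) : ℝ) * (2 * ((((2 * cth 32 1 sS + 1) ^ d : ℕ) : ℝ) * (5 : ℝ) ^ d)) + 1) *
                  (1 + 4 * 2 ^ d)) + 1)) +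
            10) + 8 * 2 ^ d * Real.log (2 * d + 1) ≤ θ)
    {K : ℕ} (hK : K₀ ≤ K) {τ : ι} (hτ : τ ∈ badTerms (memOf ped liveC (cellOfR n L s ped cellP)) jstar T K)
    {c : α} (hc : c ∈ liveC K τ) :
    ((koccOf ped liveC (cellOfR n L s ped cellP) (physV n L hn hL0 M hM s ped cellP) jstar T K
        (kslot (keyOf ped (cellOfR n L s ped cellP) (physV n L hn hL0 M hM s ped cellP) K τ c))).card : ℝ) ≤
      Real.exp (θ * birthLinT Prod.fst ((ped K τ).genT c) +
          (8 / C.E₂ * totalCostT Prod.fst C K (R K) ((ped K τ).genT c) +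
            4 * (partnerAges (PEv.step ∘ Prod.fst) ((ped K τ).genT c) : ℝ))) *
        ((L : ℝ) ^ d) ^ partnerAges (PEv.step ∘ Prod.fst) ((ped K τ).genT c) :=
  card_koccOf_le_exp_of_twin hn hL0 hL4 hn₁ hM hs hdrop hR1 H hstep hMf jstar hdis
    (htwin_concave hn hL0 hE₂ hE₃ hs hdrop hR1 H hsS hsmall hθc0 hθc1 hθcs) hθ hK hτ hc

end Instance

end

end Summit.QuantumFields.BalabanUV.T4Continuum.HistoryAssemblyMultInstanceConcave
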